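import Summits.PneNP.PneNP.Theorems.CliqueExtLowerBound.Negative.AnchoredThetaGate

/-!
# The anchored instance: anchor edge, derived vertices, class edges (anchored-theta refutation, part C1)

Part of the refutation of `stub_convReplaceable` (line `width-threshold-certificate-sparsity` of
crux stmt-PneNP-10682, `ConvexRankGates.CliqueExtLowerBound`) by the ANCHORED THETA GATE; the final
theorem is `stub_convReplaceable_false` in `ConvReplaceableFalse.lean`, whose module docstring has the
overview. Witness: at `c = 3`, for every `a`, localities `r = 3, s = 4`, at every large `m = n + 2`, the
theta programme on the `n+1` non-anchor vertices with clique parameter `k-1` (`k = ⌈m^{1/4}⌉₊`), fed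
with children `d_j = {{e₀, p_j}}`, `c_j = {{e₀, f(α,γ), f(β,γ)} : γ < h}`, is not replaceable by any
monotone circuit of size `m^a`: Jukna's criterion on the derived coordinates kills both exits.
-/

set_option linter.dupNamespace false

namespace Summit.PneNP.PneNP.Theorems.CliqueExtLowerBound.Negative

open Literature.Computability.Complexity Literature.Combinatorics.SimpleGraph Matrix Finset Filter

noncomputable section

/-! ## C. The anchored instance on `n + 2` vertices

Ambient graph `K_{n+2}`; anchor edge `e₀ = {n+1, 0}`; derived vertices `Fin (n+1)` embedded by
`Fin.castSucc` (everything except the anchor vertex `n+1`); class edges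
`f(α, γ) = {α, α + γ + 1 (mod n+1)}`; children `d_j = {{e₀, p_j}}`, `c_j = {{e₀, f(α,γ), f(β,γ)} : γ < h}`
for the `j`-th derived pair `p_j = {α, β}`. -/

section Instance

variable (n : ℕ)

/-- Edge slots of the ambient `K_{n+2}`. -/
abbrev EV (n : ℕ) : Type := (⊤ : SimpleGraph (Fin (n + 2))).edgeSet

/-- The anchor vertex `a₀ = n + 1` (not a derived vertex). -/
def aA (n : ℕ) : Fin (n + 2) := Fin.last (n + 1)

/-- The anchor vertex `b₀ = 0`. -/
def bB (n : ℕ) : Fin (n + 2) := 0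

/-- The two anchor vertices are distinct. -/
theorem aA_ne_bB : aA n ≠ bB n := by
  simp [aA, bB, Fin.ext_iff]

/-- Derived vertices are not the anchor vertex `a₀`. -/
theorem castSucc_ne_aA (α : Fin (n + 1)) : Fin.castSucc α ≠ aA n := by
  intro h
  have := congrArg Fin.val h
  simp [aA] at this
  omega

/-- An unordered pair is an edge of the complete graph iff its ends differ. -/
theorem mem_edgeSet_top_iff {V : Type*} {a b : V} :
    s(a, b) ∈ (⊤ : SimpleGraph V).edgeSet ↔ a ≠ b := by
  rw [SimpleGraph.mem_edgeSet, SimpleGraph.top_adj]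

/-- The anchor edge `e₀ = {a₀, b₀}`. -/
def e0 (n : ℕ) : EV n := ⟨s(aA n, bB n), mem_edgeSet_top_iff.2 (aA_ne_bB n)⟩

/-- The anchor edge as an unordered pair. -/
@[simp] theorem e0_coe : ((e0 n : EV n) : Sym2 (Fin (n + 2))) = s(aA n, bB n) := rfl

/-- Embedding a derived edge into the ambient graph gives an edge. -/
theorem map_castSucc_mem_edgeSet {p : Sym2 (Fin (n + 1))}
    (hp : p ∈ (⊤ : SimpleGraph (Fin (n + 1))).edgeSet) :
    p.map Fin.castSucc ∈ (⊤ : SimpleGraph (Fin (n + 2))).edgeSet := by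
  induction p using Sym2.ind with
  | _ a b =>
    rw [mem_edgeSet_top_iff] at hp
    rw [Sym2.map_mk, mem_edgeSet_top_iff]
    exact fun h => hp (Fin.castSucc_injective _ h)

/-- A derived pair viewed as an edge of the ambient graph. -/
def embE (n : ℕ) (p : EP (n + 1)) : EV n :=
  ⟨(p : Sym2 (Fin (n + 1))).map Fin.castSucc, map_castSucc_mem_edgeSet n p.2⟩

/-- The embedded derived pair as an unordered pair. -/
@[simp] theorem embE_coe (p : EP (n + 1)) :
    ((embE n p : EV n) : Sym2 (Fin (n + 2))) = (p : Sym2 (Fin (n + 1))).map Fin.castSucc := rfl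

/-- Second endpoint of the `γ`-th class edge at `α`: `α + γ + 1 (mod n + 1)`. -/
def sh (n : ℕ) (α : Fin (n + 1)) (γ : ℕ) : Fin (n + 1) :=
  ⟨(α.1 + γ + 1) % (n + 1), Nat.mod_lt _ (Nat.succ_pos n)⟩

/-- The value of the shifted endpoint `α + γ + 1 (mod n+1)`. -/
theorem sh_val (α : Fin (n + 1)) (γ : ℕ) (hγ : γ + 1 ≤ n) :
    (sh n α γ).1 = if α.1 + γ + 1 < n + 1 then α.1 + γ + 1 else α.1 + γ + 1 - (n + 1) := by
  have hα := α.2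
  simp only [sh]
  split_ifs with h
  · exact Nat.mod_eq_of_lt h
  · rw [Nat.mod_eq_sub_mod (by omega), Nat.mod_eq_of_lt (by omega)]

/-- The shifted endpoint differs from `α` (the class pair is a genuine edge). -/
theorem sh_ne (α : Fin (n + 1)) (γ : ℕ) (hγ : γ + 1 ≤ n) : sh n α γ ≠ α := by
  intro h
  have h1 := congrArg Fin.val h
  rw [sh_val n α γ hγ] at h1
  have hα := α.2
  split_ifs at h1 <;> omega

/-- The `γ`-th class edge at the derived vertex `α`, as an unordered pair of ambient vertices. -/
def fS (n : ℕ) (α : Fin (n + 1)) (γ : ℕ) : Sym2 (Fin (n + 2)) :=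
  s(Fin.castSucc α, Fin.castSucc (sh n α γ))

/-- Class pairs are edges of the ambient complete graph. -/
theorem fS_mem (α : Fin (n + 1)) {γ : ℕ} (hγ : γ + 1 ≤ n) :
    fS n α γ ∈ (⊤ : SimpleGraph (Fin (n + 2))).edgeSet := by
  rw [fS, mem_edgeSet_top_iff]
  exact fun h => sh_ne n α γ hγ (Fin.castSucc_injective _ h).symm

/-- The class edge as an edge slot (junk value `e₀` when `γ` is too large). -/
def fE (n : ℕ) (α : Fin (n + 1)) (γ : ℕ) : EV n :=
  if hγ : γ + 1 ≤ n then ⟨fS n α γ, fS_mem n α hγ⟩ else e0 n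

/-- The class edge as an unordered pair. -/
theorem fE_coe (α : Fin (n + 1)) {γ : ℕ} (hγ : γ + 1 ≤ n) :
    ((fE n α γ : EV n) : Sym2 (Fin (n + 2))) = fS n α γ := by
  simp [fE, hγ]

/-- Class pairs avoid the anchor edge. -/
theorem fS_ne_e0 (α : Fin (n + 1)) (γ : ℕ) : fS n α γ ≠ s(aA n, bB n) := by
  intro h
  rw [fS, Sym2.eq_iff] at h
  rcases h with ⟨h1, -⟩ | ⟨-, h2⟩
  · exact castSucc_ne_aA n α h1
  · exact castSucc_ne_aA n _ h2

/-- Class edges avoid the anchor edge. -/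
theorem fE_ne_e0 (α : Fin (n + 1)) {γ : ℕ} (hγ : γ + 1 ≤ n) : fE n α γ ≠ e0 n := by
  intro h
  have := congrArg (fun e : EV n => (e : Sym2 (Fin (n + 2)))) h
  simp only [fE_coe n α hγ, e0_coe] at this
  exact fS_ne_e0 n α γ this

/-- Class edges are pairwise distinct: `f(α,γ) = f(α',γ')` forces `α = α'` and `γ = γ'`
(for `γ, γ' < h` with `2h ≤ n`). -/
theorem fS_inj {h : ℕ} (hh : 2 * h ≤ n) {α α' : Fin (n + 1)} {γ γ' : ℕ} (hγ : γ < h) (hγ' : γ' < h)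
    (heq : fS n α γ = fS n α' γ') : α = α' ∧ γ = γ' := by
  have hγn : γ + 1 ≤ n := by omega
  have hγn' : γ' + 1 ≤ n := by omega
  have hα := α.2
  have hα' := α'.2
  have v1 := sh_val n α γ hγn
  have v2 := sh_val n α' γ' hγn'
  rw [fS, fS, Sym2.eq_iff] at heq
  rcases heq with ⟨h1, h2⟩ | ⟨h1, h2⟩
  · have e1 : α = α' := Fin.castSucc_injective _ h1
    subst e1
    refine ⟨rfl, ?_⟩
    have e2 := congrArg Fin.val (Fin.castSucc_injective _ h2)
    rw [v1, v2] at e2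
    split_ifs at e2 <;> omega
  · exfalso
    have e1 := congrArg Fin.val (Fin.castSucc_injective _ h1)
    have e2 := congrArg Fin.val (Fin.castSucc_injective _ h2)
    -- e1 : α = sh α' γ', e2 : sh α γ = α'
    rw [v2] at e1
    rw [v1] at e2
    split_ifs at e1 e2 <;> omega

/-- Class edges are pairwise distinct (edge-slot form of `fS_inj`). -/
theorem fE_inj {h : ℕ} (hh : 2 * h ≤ n) {α α' : Fin (n + 1)} {γ γ' : ℕ} (hγ : γ < h) (hγ' : γ' < h)
    (heq : fE n α γ = fE n α' γ') : α = α' ∧ γ = γ' := by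
  have := congrArg (fun e : EV n => (e : Sym2 (Fin (n + 2)))) heq
  simp only [fE_coe n α (show γ + 1 ≤ n by omega), fE_coe n α' (show γ' + 1 ≤ n by omega)] at this
  exact fS_inj n hh hγ hγ' this

/-! ### Derived pairs and their vertices -/

/-- The two vertices of a derived pair. -/
def verts (n : ℕ) (p : EP (n + 1)) : Finset (Fin (n + 1)) :=
  univ.filter fun α => α ∈ (p : Sym2 (Fin (n + 1)))

/-- The `j`-th derived pair. -/
def pr (n : ℕ) (j : Fin (nP (n + 1))) : EP (n + 1) := (eqv (n + 1)).symm j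

/-- A derived pair has two distinct ends. -/
theorem exists_eq_pair (p : EP (n + 1)) :
    ∃ α β : Fin (n + 1), α ≠ β ∧ (p : Sym2 (Fin (n + 1))) = s(α, β) := by
  obtain ⟨q, hq⟩ := p
  induction q using Sym2.ind with
  | _ a b => exact ⟨a, b, mem_edgeSet_top_iff.1 hq, rfl⟩

/-- The vertex set of the pair `{α, β}` is `{α, β}`. -/
theorem verts_pair {p : EP (n + 1)} {α β : Fin (n + 1)} (hp : (p : Sym2 (Fin (n + 1))) = s(α, β)) :
    verts n p = {α, β} := by
  ext v
  simp [verts, hp]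

/-- A derived pair has exactly two vertices. -/
theorem card_verts (p : EP (n + 1)) : #(verts n p) = 2 := by
  obtain ⟨α, β, hne, hp⟩ := exists_eq_pair n p
  rw [verts_pair n hp, card_pair hne]

/-- Membership in the vertex set of a derived pair. -/
theorem mem_verts {p : EP (n + 1)} {v : Fin (n + 1)} : v ∈ verts n p ↔ v ∈ (p : Sym2 (Fin (n + 1))) := by
  simp [verts]

end Instance

end

end Summit.PneNP.PneNP.Theorems.CliqueExtLowerBound.Negative
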